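import Literature.AlgebraicGeometry.Resolution.PointBlowupFlagMaximalShift
import HarnessLib

/-!
# Hauser–Perlega, Proposition 4 case (i) (the `s`-component under a monomial point blow-up): `s` drops by `d!`

H. Hauser, S. Perlega, *Resolving surface singularities in positive characteristic*, Publ. RIMS Kyoto Univ. **60**
(2024) 767–813 [cite: HauserPerlega2024], **Proposition 4** (p. 793), proof of **case (i)** "`n_𝓖 = 0` and `t = 0`"
(p. 794 l. 22 – p. 795 l. 5): the localized point blow-up `x ↦ x`, `y ↦ xy`, `z ↦ xz` at the origin of the `x`-chart,
`F′ = x^{−pᵉ} F(x, xy)`; "reduce to `h = 0` by `y ↦ y + xh(x)` in `Ô_{W,a}` prior to the blowup"; "`d_𝓖 = d′_res ≤ d_res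
= d_𝓕`. Assume that equality holds"; "`F′ = M′·G′`, where `M′(x,y) = x^{d_res−pᵉ}M(x,xy)` and `G′(x,y) = x^{−d_res}G(x,xy)`";
"If `G₁ = V(z,x)` and `d_res ≥ pᵉ`, the numeral `s_𝓖` hence has the minimal value `s_𝓖 = d_res!` … Consequently, we may
assume … `G₁ = V(z,y)`. It is now straightforward to prove the equality of coefficient ideals
`coeff_{d_𝓖}(G′) = x^{−d_res}·coeff_{d_𝓕}(G)` … This proves that `s_𝓖 < s_𝓕`."

## What is proved (sorry-free; any field `K` of characteristic `p`; NO new definition, NO named fact)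

* Section A — ROWS: under the row law of the monomial step "`G′_i = x^{i−d}·G_i`" (`[x^a]G′_i = [x^{a+d−i}]G_i`, `i < d`)
  the numeral satisfies **`s′ + d! = s`** (`inf_rows_add_factorial_eq_of_step` — the coefficient-ideal identity
  `coeff_d(G′) = x^{−d}·coeff_d(G)`); `d! ≤ s` always (`factorial_le_inf_rows`); a row term of degree `d` off the
  `y^d`-corner gives `s ≤ d!` (`inf_rows_le_factorial_of_coeff_ne_zero`: the swapped flag `G₁ = V(z, x)` is minimal).
* Section B — SERIES: the monomial substitution `y ↦ xy` (`coeff_subst_step`), its commutation with the triangular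
  shifts — **`(y ↦ y + φ(x)) ∘ (y ↦ xy) = (y ↦ xy) ∘ (y ↦ y + x·φ(x))`** (`subst_shift_subst_step`: the flag `y + h(x)` at
  `a′` is the flag `y + x·h(x)` at `a`) — and with the cleaning (`cleanSeries_subst_step`).
* Section C — THE STEP ON ROWS: for `x^{pᵉ}·H′ = H(x, xy)` (the successor germ, given by this identity), `r′ + pᵉ =
  r + d`: the rows of `clean_q(H′(x, y + φ))/x^{r′}` are the `x^{i−d}`-shifts of the rows of `clean_q(H(x, y + xφ))/x^r`
  (`coeff_cleanShift_step_row`); hence `d′ ≤ d` for the successor's residual order (`residual_le_of_step`, with the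
  `y^d`-corner term when `d′ = d`), **`s′⟨φ⟩ + d! = s⟨x·φ⟩`** (`inf_rows_step_add_factorial`), and the case-(i)
  conclusion of Proposition 4 for the `s`-component: if `s ≤ S` over all shifts at `a` (Proposition 3, file
  `PointBlowupFlagMaximalShift`), then `s′⟨φ⟩ + d! ≤ S` for every shift `φ` at `a′` (`inf_rows_step_add_factorial_le`).

## What is NOT proved here

The typed corollary on `PointBlowup.step` / `FlagInvariantDropsStatement`; the companion branch `0 < d_res < pᵉ`
("`s_𝓖 = (d_res(pᵉ − d_res))!`", "`coeff_{q_𝓖}(M′^{d} + G′^{pᵉ−d}) = x^{−q_𝓕}·coeff…`"); cases (ii)–(iv).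

Provenance: seat res-D-pv-058 acting as res-L1-w43-stub-6 (cell res-hironaka, chain W4.3), 2026-08-27; a Literature
transcription of a PRINTED, refereed proposition in the tree's power-series model — not a statement about any
manuscript under adjudication.
-/

noncomputable section

open MvPolynomial Finset
open scoped BigOperators

namespace Literature.AlgebraicGeometry.Resolution

open Literature.AlgebraicGeometry.Resolution.Hauser2010
open Literature.AlgebraicGeometry.Resolution.PointBlowup
open Literature.AlgebraicGeometry.Resolution.HauserWagner2014

namespace HauserPerlega2024

/-! ## A. Rows under the monomial step `G′_i = x^{i−d}·G_i` -/

section Rows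

variable {K : Type*} [Field K]

/-- dropping the first `m` (vanishing) coefficients lowers the order by exactly `m`. [folklore] -/
private theorem order_add_eq_of_coeff_shift {G G' : PowerSeries K} {m : ℕ}
    (hG' : ∀ a, PowerSeries.coeff a G' = PowerSeries.coeff (a + m) G) (hmin : ∀ a, a < m → PowerSeries.coeff a G = 0) :
    G'.order + m = G.order := by
  by_cases hG : G = 0
  · have hG'0 : G' = 0 := by
      ext a
      rw [hG', hG, map_zero, map_zero]
    rw [hG, hG'0, PowerSeries.order_zero, top_add]
  · have hn := PowerSeries.coe_toNat_order hG
    set n := G.order.toNat with hndef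
    have hmn : m ≤ n := by
      have h1 := PowerSeries.nat_le_order G m fun a ha => hmin a ha
      rw [← hn] at h1
      exact_mod_cast h1
    have hG'ord : G'.order = ((n - m : ℕ) : ℕ∞) := by
      apply le_antisymm
      · apply PowerSeries.order_le
        rw [hG', Nat.sub_add_cancel hmn]
        have := PowerSeries.coeff_order hG
        rwa [← hn] at this
      · refine PowerSeries.nat_le_order _ _ fun a ha => ?_
        rw [hG']
        apply PowerSeries.coeff_of_lt_order
        rw [← hn]
        exact_mod_cast (show a + m < n by omega)
    rw [hG'ord, ← hn, ← Nat.cast_add, Nat.sub_add_cancel hmn]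

/-- **`coeff_d(G′) = x^{−d}·coeff_d(G)` on rows: `s′ + d! = s`.**  If the rows `i < d` of `G′` are the rows of `G` shifted
down by `d − i` ("`G′(x,y) = x^{−d_res}G(x,xy)`", so `G′_i = x^{i−d}·G_i`) and every row `G_i` vanishes below degree
`d − i`, then `min_{i<d} (d!/(d−i))·ord G′_i + d! = min_{i<d} (d!/(d−i))·ord G_i`.
[cite: HauserPerlega2024, Prop. 4 proof case (i) p. 794 l. 40 – p. 795 l. 5] -/
theorem inf_rows_add_factorial_eq_of_step {d : ℕ} (G G' : ℕ → PowerSeries K)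
    (hG' : ∀ i, i < d → ∀ a, PowerSeries.coeff a (G' i) = PowerSeries.coeff (a + (d - i)) (G i))
    (hmin : ∀ i a, PowerSeries.coeff a (G i) ≠ 0 → d ≤ i + a) :
    (Finset.range d).inf (fun i => ((d.factorial / (d - i) : ℕ) : ℕ∞) * (G' i).order) + (d.factorial : ℕ∞) =
      (Finset.range d).inf (fun i => ((d.factorial / (d - i) : ℕ) : ℕ∞) * (G i).order) := by
  have hmono : Monotone (fun t : ℕ∞ => t + (d.factorial : ℕ∞)) := fun a b h => add_le_add h le_rfl
  rw [Finset.apply_inf_eq_inf_comp_of_linearOrder (s := Finset.range d)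
    (f := fun i => ((d.factorial / (d - i) : ℕ) : ℕ∞) * (G' i).order) (fun t : ℕ∞ => t + (d.factorial : ℕ∞)) hmono
    (top_add _)]
  refine Finset.inf_congr rfl fun i hi => ?_
  rw [Finset.mem_range] at hi
  have hcd : d.factorial / (d - i) * (d - i) = d.factorial :=
    Nat.div_mul_cancel (Nat.dvd_factorial (by omega) (by omega))
  have hrow := order_add_eq_of_coeff_shift (hG' i hi) (fun a ha => by
    by_contra hne
    have := hmin i a hne
    omega)
  simp only [Function.comp_apply]
  rw [← hrow, mul_add]
  congr 1
  rw [← Nat.cast_mul, hcd]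

/-- **`s ≥ d!` always**: if every row `G_i` vanishes below degree `d − i` then `min_{i<d} (d!/(d−i))·ord G_i ≥ d!`.
[cite: HauserPerlega2024, Prop. 4 proof case (i) p. 794 l. 43–45 ("the minimal value s_𝓖 = d_res!")] -/
theorem factorial_le_inf_rows {d : ℕ} (G : ℕ → PowerSeries K)
    (hmin : ∀ i a, PowerSeries.coeff a (G i) ≠ 0 → d ≤ i + a) :
    (d.factorial : ℕ∞) ≤ (Finset.range d).inf (fun i => ((d.factorial / (d - i) : ℕ) : ℕ∞) * (G i).order) := by
  refine Finset.le_inf fun i hi => ?_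
  rw [Finset.mem_range] at hi
  have hcd : d.factorial / (d - i) * (d - i) = d.factorial :=
    Nat.div_mul_cancel (Nat.dvd_factorial (by omega) (by omega))
  have h1 : ((d - i : ℕ) : ℕ∞) ≤ (G i).order := PowerSeries.nat_le_order _ _ fun a ha => by
    by_contra hne
    have := hmin i a hne
    omega
  calc (d.factorial : ℕ∞) = ((d.factorial / (d - i) : ℕ) : ℕ∞) * ((d - i : ℕ) : ℕ∞) := by
        rw [← Nat.cast_mul, hcd]
    _ ≤ ((d.factorial / (d - i) : ℕ) : ℕ∞) * (G i).order := mul_le_mul_of_nonneg_left h1 zero_le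

/-- **the swapped flag is minimal**: a row coefficient `[x^a]G_i ≠ 0` with `i < d` and `i + a = d` (a term of degree `d`
off the corner `y^d`) gives `min_{i<d} (d!/(d−i))·ord G_i ≤ d!` ("If `G₁ = V(z,x)` … `s_𝓖 = d_res!`": read with the
letters swapped, the term `c_{d_res} y^{d_res}` of `G′` lies in row `0`).
[cite: HauserPerlega2024, Prop. 4 proof case (i) p. 794 l. 40–45] -/
theorem inf_rows_le_factorial_of_coeff_ne_zero {d : ℕ} (G : ℕ → PowerSeries K) {i a : ℕ} (hi : i < d)
    (hia : i + a = d) (hne : PowerSeries.coeff a (G i) ≠ 0) :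
    (Finset.range d).inf (fun i => ((d.factorial / (d - i) : ℕ) : ℕ∞) * (G i).order) ≤ (d.factorial : ℕ∞) := by
  have hcd : d.factorial / (d - i) * (d - i) = d.factorial :=
    Nat.div_mul_cancel (Nat.dvd_factorial (by omega) (by omega))
  calc (Finset.range d).inf (fun i => ((d.factorial / (d - i) : ℕ) : ℕ∞) * (G i).order)
      ≤ ((d.factorial / (d - i) : ℕ) : ℕ∞) * (G i).order := Finset.inf_le (Finset.mem_range.mpr hi)
    _ ≤ ((d.factorial / (d - i) : ℕ) : ℕ∞) * (a : ℕ∞) := mul_le_mul_of_nonneg_left (PowerSeries.order_le a hne) zero_le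
    _ = (d.factorial : ℕ∞) := by rw [← Nat.cast_mul, show a = d - i by omega, hcd]

end Rows

/-! ## B. Series: the monomial substitution `y ↦ xy` and the triangular shifts -/

section Step

variable {σ : Type*} {K : Type*} [Field K]

/-- the exponent `x^a y^b` evaluated at `x`. [folklore] -/
private theorem ssa_left {x y : σ} (hxy : x ≠ y) (a b : ℕ) :
    (Finsupp.single x a + Finsupp.single y b) x = a := by
  classical
  rw [Finsupp.add_apply, Finsupp.single_eq_same, Finsupp.single_apply, if_neg (Ne.symm hxy), add_zero]

/-- the exponent `x^a y^b` evaluated at `y`. [folklore] -/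
private theorem ssa_right {x y : σ} (hxy : x ≠ y) (a b : ℕ) :
    (Finsupp.single x a + Finsupp.single y b) y = b := by
  classical
  rw [Finsupp.add_apply, Finsupp.single_eq_same, Finsupp.single_apply, if_neg hxy, zero_add]

/-- two letters: an exponent is determined by its two entries. [folklore] -/
private theorem fs_eq_two {x y : σ} (hσ : ∀ l, l = x ∨ l = y) {d d' : σ →₀ ℕ} (hx : d x = d' x)
    (hy : d y = d' y) : d = d' := by
  ext l
  rcases hσ l with rfl | rfl
  · exact hx
  · exact hy

/-- two letters: every exponent is `x^{d_x} y^{d_y}`. [folklore] -/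
private theorem eq_ssa {x y : σ} (hxy : x ≠ y) (hσ : ∀ l, l = x ∨ l = y) (d : σ →₀ ℕ) :
    d = Finsupp.single x (d x) + Finsupp.single y (d y) :=
  fs_eq_two hσ (ssa_left hxy _ _).symm (ssa_right hxy _ _).symm

/-- two letters: "all entries divisible by `q`". [folklore] -/
private theorem forall_dvd_two {x y : σ} (hσ : ∀ l, l = x ∨ l = y) (q : ℕ) (d : σ →₀ ℕ) :
    (∀ l, q ∣ d l) ↔ q ∣ d x ∧ q ∣ d y := by
  refine ⟨fun h => ⟨h x, h y⟩, fun h l => ?_⟩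
  rcases hσ l with rfl | rfl
  · exact h.1
  · exact h.2

open scoped Classical in
/-- unfolding the cleaning. [folklore] -/
private theorem coeff_cleanSeries' (q : ℕ) (H : MvPowerSeries σ K) (d : σ →₀ ℕ) :
    MvPowerSeries.coeff d (cleanSeries q H) = if ∀ i, q ∣ d i then 0 else MvPowerSeries.coeff d H := rfl

variable [Fintype σ] [DecidableEq σ]

/-- the monomial substitution `y ↦ xy` (the `x`-chart of the point blow-up) is substitutable.
[cite: HauserPerlega2024, §2 p. 774 (φ(x) = x, φ(y) = xy, φ(z) = xz)] -/
theorem hasSubst_step (x y : σ) :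
    MvPowerSeries.HasSubst (fun l => if l = y then (MvPowerSeries.X x : MvPowerSeries σ K) * MvPowerSeries.X y
        else MvPowerSeries.X l) := by
  refine MvPowerSeries.hasSubst_of_constantCoeff_zero fun l => ?_
  by_cases hl : l = y
  · simp only [hl, if_true, map_mul, MvPowerSeries.constantCoeff_X, mul_zero]
  · simp only [if_neg hl, MvPowerSeries.constantCoeff_X]

/-- **The coefficients of `S(x, xy)`**: `[x^{m_x} y^{m_y}] S(x, xy) = [x^{m_x − m_y} y^{m_y}] S` if `m_y ≤ m_x`, else `0`
("`F′ = x^{−pᵉ}·φ(F)`" collects `[x^a y^b]F` at `x^{a+b−pᵉ} y^b`). [cite: HauserPerlega2024, §2 p. 774 l. 9–13] -/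
theorem coeff_subst_step (x y : σ) (hxy : x ≠ y) (hσ : ∀ l, l = x ∨ l = y) (S : MvPowerSeries σ K)
    (m : σ →₀ ℕ) :
    MvPowerSeries.coeff m (MvPowerSeries.subst (fun l => if l = y then (MvPowerSeries.X x : MvPowerSeries σ K) * MvPowerSeries.X y
        else MvPowerSeries.X l) S) =
      if m y ≤ m x then MvPowerSeries.coeff (Finsupp.single x (m x - m y) + Finsupp.single y (m y)) S else 0 := by
  classical
  have huniv : (Finset.univ : Finset σ) = {x, y} := by
    ext l
    simp only [Finset.mem_univ, Finset.mem_insert, Finset.mem_singleton, true_iff]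
    exact hσ l
  have hprod : ∀ d : σ →₀ ℕ, (d.prod fun s n => ((fun l => if l = y then (MvPowerSeries.X x : MvPowerSeries σ K) * MvPowerSeries.X y
        else MvPowerSeries.X l) s) ^ n) =
      MvPowerSeries.monomial (Finsupp.single x (d x + d y) + Finsupp.single y (d y)) (1 : K) := by
    intro d
    rw [Finsupp.prod_fintype _ _ (fun l => pow_zero _), huniv, Finset.prod_pair hxy, if_neg hxy, if_pos rfl, mul_pow,
      ← mul_assoc, ← pow_add, MvPowerSeries.X_pow_eq, MvPowerSeries.X_pow_eq, MvPowerSeries.monomial_mul_monomial,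
      one_mul]
  rw [MvPowerSeries.coeff_subst (hasSubst_step x y) S m]
  simp_rw [hprod, MvPowerSeries.coeff_monomial]
  split_ifs with hle
  · rw [finsum_eq_single _ (Finsupp.single x (m x - m y) + Finsupp.single y (m y))]
    · rw [ssa_left hxy, ssa_right hxy, if_pos, smul_eq_mul, mul_one]
      exact (eq_ssa hxy hσ m).trans (by rw [Nat.sub_add_cancel hle])
    · intro d hd
      rw [if_neg, smul_zero]
      intro hm
      apply hd
      have h1 := congrArg (fun f : σ →₀ ℕ => f x) hm
      have h2 := congrArg (fun f : σ →₀ ℕ => f y) hm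
      simp only [ssa_left hxy, ssa_right hxy] at h1 h2
      apply fs_eq_two hσ
      · rw [ssa_left hxy]; omega
      · rw [ssa_right hxy]; omega
  · apply finsum_eq_zero_of_forall_eq_zero
    intro d
    rw [if_neg, smul_zero]
    intro hm
    have h1 := congrArg (fun f : σ →₀ ℕ => f x) hm
    have h2 := congrArg (fun f : σ →₀ ℕ => f y) hm
    simp only [ssa_left hxy, ssa_right hxy] at h1 h2
    omega

/-- **The flag `y + h(x)` at `a′` is the flag `y + x·h(x)` at `a`**: `(y ↦ y + φ(x))` after `(y ↦ xy)` equals `(y ↦ xy)`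
after `(y ↦ y + x·φ(x))`, as substitutions of `K[[x, y]]` — "reduce to `h = 0` by `y ↦ y + xh(x)` in `Ô_{W,a}` prior to
the blowup". [cite: HauserPerlega2024, Prop. 4 proof case (i) p. 794 l. 22–26] -/
theorem subst_shift_subst_step (x y : σ) (hxy : x ≠ y) (φ : PowerSeries K) (hφ : PowerSeries.constantCoeff φ = 0)
    (H : MvPowerSeries σ K) :
    MvPowerSeries.subst (fun l => if l = y then
        (MvPowerSeries.X y : MvPowerSeries σ K) + PowerSeries.subst (MvPowerSeries.X x : MvPowerSeries σ K) φ
        else MvPowerSeries.X l) (MvPowerSeries.subst (fun l => if l = y then (MvPowerSeries.X x : MvPowerSeries σ K) * MvPowerSeries.X y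
        else MvPowerSeries.X l) H) =
      MvPowerSeries.subst (fun l => if l = y then (MvPowerSeries.X x : MvPowerSeries σ K) * MvPowerSeries.X y
        else MvPowerSeries.X l) (MvPowerSeries.subst (fun l => if l = y then
        (MvPowerSeries.X y : MvPowerSeries σ K) + PowerSeries.subst (MvPowerSeries.X x : MvPowerSeries σ K) (PowerSeries.X * φ)
        else MvPowerSeries.X l) H) := by
  have hst := hasSubst_step (K := K) x y
  have hsh := hasSubst_shift x y φ hφ
  have hXφ : PowerSeries.constantCoeff (PowerSeries.X * φ) = 0 := by
    rw [map_mul, PowerSeries.constantCoeff_X, zero_mul]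
  have hshX := hasSubst_shift x y (PowerSeries.X * φ) hXφ
  -- the inner univariate series is untouched by `y ↦ xy`
  have hψ : MvPowerSeries.subst (fun l => if l = y then (MvPowerSeries.X x : MvPowerSeries σ K) * MvPowerSeries.X y
        else MvPowerSeries.X l) (PowerSeries.subst (MvPowerSeries.X x : MvPowerSeries σ K) φ) =
      PowerSeries.subst (MvPowerSeries.X x : MvPowerSeries σ K) φ := by
    have e1 : PowerSeries.subst (MvPowerSeries.X x : MvPowerSeries σ K) φ =
        MvPowerSeries.subst (fun _ : Unit => (MvPowerSeries.X x : MvPowerSeries σ K)) φ := PowerSeries.subst_def _ _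
    rw [e1, MvPowerSeries.subst_comp_subst_apply (PowerSeries.HasSubst.const (PowerSeries.HasSubst.X x)) hst]
    congr 1
    funext u
    rw [MvPowerSeries.subst_X hst, if_neg hxy]
  rw [MvPowerSeries.subst_comp_subst_apply hst hsh, MvPowerSeries.subst_comp_subst_apply hshX hst]
  congr 1
  funext l
  by_cases hl : l = y
  · simp only [hl, if_true]
    rw [MvPowerSeries.subst_mul hsh, MvPowerSeries.subst_X hsh, MvPowerSeries.subst_X hsh, if_neg hxy, if_pos rfl,
      MvPowerSeries.subst_add hst, MvPowerSeries.subst_X hst, if_pos rfl,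
      PowerSeries.subst_mul (PowerSeries.HasSubst.X x), PowerSeries.subst_X (PowerSeries.HasSubst.X x),
      MvPowerSeries.subst_mul hst, MvPowerSeries.subst_X hst, if_neg hxy, hψ]
    ring
  · simp only [if_neg hl]
    rw [MvPowerSeries.subst_X hsh, if_neg hl, MvPowerSeries.subst_X hst, if_neg hl]

/-- **cleaning commutes with `y ↦ xy`**: the monomial step permutes exponents by `(a, b) ↦ (a + b, b)`, which preserves
`q`-divisibility of both entries — "the expansion of `F′(x,y)` is again clean if … `Z = {a}` and `t = 0`".
[cite: HauserPerlega2024, §2 p. 774 l. 18–20] -/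
theorem cleanSeries_subst_step (q : ℕ) (x y : σ) (hxy : x ≠ y) (hσ : ∀ l, l = x ∨ l = y) (S : MvPowerSeries σ K) :
    cleanSeries q (MvPowerSeries.subst (fun l => if l = y then (MvPowerSeries.X x : MvPowerSeries σ K) * MvPowerSeries.X y
        else MvPowerSeries.X l) S) = MvPowerSeries.subst (fun l => if l = y then (MvPowerSeries.X x : MvPowerSeries σ K) * MvPowerSeries.X y
        else MvPowerSeries.X l) (cleanSeries q S) := by
  classical
  ext m
  rw [coeff_cleanSeries', coeff_subst_step x y hxy hσ, coeff_subst_step x y hxy hσ, coeff_cleanSeries']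
  simp only [forall_dvd_two hσ, ssa_left hxy, ssa_right hxy]
  by_cases hle : m y ≤ m x
  · rw [if_pos hle, if_pos hle]
    have hiff : (q ∣ m x ∧ q ∣ m y) ↔ (q ∣ m x - m y ∧ q ∣ m y) := by
      constructor
      · rintro ⟨h1, h2⟩; exact ⟨Nat.dvd_sub h1 h2, h2⟩
      · rintro ⟨h1, h2⟩
        refine ⟨?_, h2⟩
        have := Nat.dvd_add h1 h2
        rwa [Nat.sub_add_cancel hle] at this
    by_cases hd : q ∣ m x ∧ q ∣ m y
    · rw [if_pos hd, if_pos (hiff.mp hd)]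
    · rw [if_neg hd, if_neg (fun h => hd (hiff.mpr h))]
  · rw [if_neg hle, if_neg hle]
    split_ifs <;> rfl

omit [Fintype σ] in
/-- cleaning commutes with multiplication by `x^q` (the shift `a ↦ a + q` preserves `q ∣ a`). [folklore] -/
private theorem cleanSeries_X_pow_mul (q : ℕ) (x y : σ) (hxy : x ≠ y) (hσ : ∀ l, l = x ∨ l = y)
    (T : MvPowerSeries σ K) :
    cleanSeries q ((MvPowerSeries.X x : MvPowerSeries σ K) ^ q * T) =
      (MvPowerSeries.X x : MvPowerSeries σ K) ^ q * cleanSeries q T := by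
  classical
  ext m
  rw [coeff_cleanSeries', MvPowerSeries.X_pow_eq, MvPowerSeries.coeff_monomial_mul, MvPowerSeries.coeff_monomial_mul,
    coeff_cleanSeries']
  simp only [forall_dvd_two hσ]
  by_cases hle : Finsupp.single x q ≤ m
  · rw [if_pos hle, if_pos hle, one_mul, one_mul]
    have hmx : q ≤ m x := by have := hle x; rwa [Finsupp.single_eq_same] at this
    have h1 : (m - Finsupp.single x q) x = m x - q := by rw [Finsupp.tsub_apply, Finsupp.single_eq_same]
    have h2 : (m - Finsupp.single x q) y = m y := by
      rw [Finsupp.tsub_apply, Finsupp.single_apply, if_neg hxy, Nat.sub_zero]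
    rw [h1, h2]
    have hiff : (q ∣ m x ∧ q ∣ m y) ↔ (q ∣ m x - q ∧ q ∣ m y) := by
      constructor
      · rintro ⟨h3, h4⟩; exact ⟨Nat.dvd_sub h3 dvd_rfl, h4⟩
      · rintro ⟨h3, h4⟩
        refine ⟨?_, h4⟩
        have := Nat.dvd_add h3 (dvd_refl q)
        rwa [Nat.sub_add_cancel hmx] at this
    by_cases hd : q ∣ m x ∧ q ∣ m y
    · rw [if_pos hd, if_pos (hiff.mp hd)]
    · rw [if_neg hd, if_neg (fun h => hd (hiff.mpr h))]
  · rw [if_neg hle, if_neg hle]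
    split_ifs <;> rfl

end Step

/-! ## C. The monomial point step on the rows of the cleaned shifted expansions -/

section StepRows

variable {σ : Type*} [Fintype σ] [DecidableEq σ] {K : Type*} [Field K]

/-- **The row law of the monomial step.**  Let `x^q·H′ = H(x, xy)` (the successor germ `H′ = x^{−pᵉ}H(x,xy)` of the
`x`-chart, `t = 0`) and `r′ + q = r + d` (the new exceptional exponent, "`M′(x,y) = x^{d_res−pᵉ}M(x,xy)`").  Then for
every shift `φ` the rows of `clean_q(H′(x, y + φ))/x^{r′}` are the rows of `clean_q(H(x, y + x·φ))/x^{r}` shifted down: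
`[x^a]G′_i = [x^{a+d−i}]G_i` (`i ≤ d`) — "`G′(x,y) = x^{−d_res}G(x,xy)`", read along the flag `y + h(x)` at `a′` and the
flag `y + xh(x)` at `a`. [cite: HauserPerlega2024, Prop. 4 proof case (i) p. 794 l. 22–40] -/
theorem coeff_cleanShift_step_row (q : ℕ) (x y : σ) (hxy : x ≠ y) (hσ : ∀ l, l = x ∨ l = y)
    (H H' : MvPowerSeries σ K)
    (hH' : (MvPowerSeries.X x : MvPowerSeries σ K) ^ q * H' = MvPowerSeries.subst (fun l => if l = y then (MvPowerSeries.X x : MvPowerSeries σ K) * MvPowerSeries.X y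
        else MvPowerSeries.X l) H)
    (r r' d : ℕ) (hr' : r' + q = r + d) (φ : PowerSeries K) (hφ : PowerSeries.constantCoeff φ = 0)
    (R R' : ℕ → PowerSeries K)
    (hR : ∀ j v, PowerSeries.coeff v (R j) = MvPowerSeries.coeff (Finsupp.single x (r + v) + Finsupp.single y j)
      (cleanSeries q (MvPowerSeries.subst (fun l => if l = y then
        (MvPowerSeries.X y : MvPowerSeries σ K) + PowerSeries.subst (MvPowerSeries.X x : MvPowerSeries σ K) (PowerSeries.X * φ)
        else MvPowerSeries.X l) H)))
    (hR' : ∀ j v, PowerSeries.coeff v (R' j) = MvPowerSeries.coeff (Finsupp.single x (r' + v) + Finsupp.single y j)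
      (cleanSeries q (MvPowerSeries.subst (fun l => if l = y then
        (MvPowerSeries.X y : MvPowerSeries σ K) + PowerSeries.subst (MvPowerSeries.X x : MvPowerSeries σ K) φ
        else MvPowerSeries.X l) H'))) :
    ∀ i a, i ≤ d → PowerSeries.coeff a (R' i) = PowerSeries.coeff (a + (d - i)) (R i) := by
  classical
  intro i a hid
  have hsh := hasSubst_shift x y φ hφ
  set T := MvPowerSeries.subst (fun l => if l = y then
        (MvPowerSeries.X y : MvPowerSeries σ K) + PowerSeries.subst (MvPowerSeries.X x : MvPowerSeries σ K) φ
        else MvPowerSeries.X l) H' with hTdef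
  set S := MvPowerSeries.subst (fun l => if l = y then
        (MvPowerSeries.X y : MvPowerSeries σ K) + PowerSeries.subst (MvPowerSeries.X x : MvPowerSeries σ K) (PowerSeries.X * φ)
        else MvPowerSeries.X l) H with hSdef
  have hT : (MvPowerSeries.X x : MvPowerSeries σ K) ^ q * T = MvPowerSeries.subst (fun l => if l = y then (MvPowerSeries.X x : MvPowerSeries σ K) * MvPowerSeries.X y
        else MvPowerSeries.X l) S := by
    rw [hSdef, ← subst_shift_subst_step x y hxy φ hφ H, ← hH', MvPowerSeries.subst_mul hsh, MvPowerSeries.subst_pow hsh,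
      MvPowerSeries.subst_X hsh, if_neg hxy]
  set n : σ →₀ ℕ := Finsupp.single x (r' + a) + Finsupp.single y i with hndef
  have h1 : MvPowerSeries.coeff n (cleanSeries q T) =
      MvPowerSeries.coeff (n + Finsupp.single x q) ((MvPowerSeries.X x : MvPowerSeries σ K) ^ q * cleanSeries q T) := by
    rw [MvPowerSeries.X_pow_eq, MvPowerSeries.coeff_monomial_mul, if_pos le_add_self, one_mul, add_tsub_cancel_right]
  have hmx : (n + Finsupp.single x q) x = r' + a + q := by
    rw [Finsupp.add_apply, hndef, ssa_left hxy, Finsupp.single_eq_same]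
  have hmy : (n + Finsupp.single x q) y = i := by
    rw [Finsupp.add_apply, hndef, ssa_right hxy, Finsupp.single_apply, if_neg hxy, add_zero]
  rw [hR', hR, ← hndef, h1, ← cleanSeries_X_pow_mul q x y hxy hσ T, hT, cleanSeries_subst_step q x y hxy hσ S,
    coeff_subst_step x y hxy hσ, hmx, hmy, if_pos (by omega), show r' + a + q - i = r + (a + (d - i)) by omega]

/-- **`d′_res ≤ d_res` under the monomial step** ("Since either one or no component is lost under such blowups, we know
that `d_𝓖 = d′_res ≤ d_res = d_𝓕`"): if `H` has all monomials of degree `≥ r + d` and a clean one of degree `r + d`,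
and `H′` (`x^q·H′ = H(x,xy)`, `r′ + q = r + d`) has all monomials of degree `≥ r′ + d′`, then `d′ ≤ d`.
[cite: HauserPerlega2024, Prop. 4 proof case (i) p. 794 l. 30–33; §4 p. 779 l. 13–14] -/
theorem residual_le_of_step (p : ℕ) [Fact p.Prime] [CharP K p] {e : ℕ} (x y : σ) (hxy : x ≠ y)
    (hσ : ∀ l, l = x ∨ l = y) (H H' : MvPowerSeries σ K)
    (hH' : (MvPowerSeries.X x : MvPowerSeries σ K) ^ p ^ e * H' = MvPowerSeries.subst (fun l => if l = y then (MvPowerSeries.X x : MvPowerSeries σ K) * MvPowerSeries.X y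
        else MvPowerSeries.X l) H)
    (r r' d d' : ℕ) (hr' : r' + p ^ e = r + d)
    (hxr : ∀ m, MvPowerSeries.coeff m H ≠ 0 → r ≤ m x)
    (hminH : ∀ m, MvPowerSeries.coeff m H ≠ 0 → r + d ≤ m x + m y)
    (hexH : ∃ m, MvPowerSeries.coeff m (cleanSeries (p ^ e) H) ≠ 0 ∧ m x + m y = r + d)
    (hminH' : ∀ m, MvPowerSeries.coeff m H' ≠ 0 → r' + d' ≤ m x + m y) : d' ≤ d := by
  classical
  have h00 : PowerSeries.constantCoeff (0 : PowerSeries K) = 0 := map_zero _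
  have hX0 : PowerSeries.constantCoeff (PowerSeries.X * (0 : PowerSeries K)) = 0 := by rw [mul_zero, map_zero]
  set R : ℕ → PowerSeries K := fun j => PowerSeries.mk fun v =>
    MvPowerSeries.coeff (Finsupp.single x (r + v) + Finsupp.single y j)
      (cleanSeries (p ^ e) (MvPowerSeries.subst (fun l => if l = y then
        (MvPowerSeries.X y : MvPowerSeries σ K) + PowerSeries.subst (MvPowerSeries.X x : MvPowerSeries σ K) (PowerSeries.X * (0 : PowerSeries K))
        else MvPowerSeries.X l) H)) with hRdef
  set R' : ℕ → PowerSeries K := fun j => PowerSeries.mk fun v =>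
    MvPowerSeries.coeff (Finsupp.single x (r' + v) + Finsupp.single y j)
      (cleanSeries (p ^ e) (MvPowerSeries.subst (fun l => if l = y then
        (MvPowerSeries.X y : MvPowerSeries σ K) + PowerSeries.subst (MvPowerSeries.X x : MvPowerSeries σ K) (0 : PowerSeries K)
        else MvPowerSeries.X l) H')) with hR'def
  have hR : ∀ j v, PowerSeries.coeff v (R j) = MvPowerSeries.coeff (Finsupp.single x (r + v) + Finsupp.single y j)
      (cleanSeries (p ^ e) (MvPowerSeries.subst (fun l => if l = y then
        (MvPowerSeries.X y : MvPowerSeries σ K) + PowerSeries.subst (MvPowerSeries.X x : MvPowerSeries σ K) (PowerSeries.X * (0 : PowerSeries K))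
        else MvPowerSeries.X l) H)) := fun j v => by rw [hRdef, PowerSeries.coeff_mk]
  have hR' : ∀ j v, PowerSeries.coeff v (R' j) = MvPowerSeries.coeff (Finsupp.single x (r' + v) + Finsupp.single y j)
      (cleanSeries (p ^ e) (MvPowerSeries.subst (fun l => if l = y then
        (MvPowerSeries.X y : MvPowerSeries σ K) + PowerSeries.subst (MvPowerSeries.X x : MvPowerSeries σ K) (0 : PowerSeries K)
        else MvPowerSeries.X l) H')) := fun j v => by rw [hR'def, PowerSeries.coeff_mk]
  obtain ⟨i, a, hia, hsum⟩ :=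
    cleanShift_rows_exists_degree_eq p e x y hxy hσ H r d hxr hminH hexH (PowerSeries.X * 0) hX0 R hR
  have hstep := coeff_cleanShift_step_row (p ^ e) x y hxy hσ H H' hH' r r' d hr' 0 h00 R R' hR hR' i 0 (by omega)
  rw [zero_add, show d - i = a by omega] at hstep
  have hne : PowerSeries.coeff 0 (R' i) ≠ 0 := by rw [hstep]; exact hia
  rw [hR', Nat.add_zero] at hne
  have h1 := (coeff_cleanSeries_of_ne_zero (p ^ e) _ _ hne).1
  rw [h1] at hne
  obtain ⟨dd, hdd, -, -, hdeg⟩ := exists_coeff_ne_zero_of_coeff_subst_shift x y hxy hσ 0 h00 H' _ hne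
  have h2 := hminH' dd hdd
  rw [ssa_left hxy, ssa_right hxy] at hdeg
  omega

/-- **the `y^d`-corner of the successor**: if moreover `d′ = d`, then along every shift `φ` the row `d` of
`clean_q(H′(x, y + φ))/x^{r′}` has a non-zero constant term — the monomial `c_{d_res} y^{d_res}` of `G′` ("`c_{d_res} ≠ 0`"),
which makes the swapped flag `G₁ = V(z, x)` minimal (`inf_rows_le_factorial_of_coeff_ne_zero`).
[cite: HauserPerlega2024, Prop. 4 proof case (i) p. 794 l. 36–45] -/
theorem coeff_corner_ne_zero_of_step (p : ℕ) [Fact p.Prime] [CharP K p] {e : ℕ} (x y : σ) (hxy : x ≠ y)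
    (hσ : ∀ l, l = x ∨ l = y) (H H' : MvPowerSeries σ K)
    (hH' : (MvPowerSeries.X x : MvPowerSeries σ K) ^ p ^ e * H' = MvPowerSeries.subst (fun l => if l = y then (MvPowerSeries.X x : MvPowerSeries σ K) * MvPowerSeries.X y
        else MvPowerSeries.X l) H)
    (r r' d : ℕ) (hr' : r' + p ^ e = r + d)
    (hxr : ∀ m, MvPowerSeries.coeff m H ≠ 0 → r ≤ m x)
    (hminH : ∀ m, MvPowerSeries.coeff m H ≠ 0 → r + d ≤ m x + m y)
    (hexH : ∃ m, MvPowerSeries.coeff m (cleanSeries (p ^ e) H) ≠ 0 ∧ m x + m y = r + d)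
    (hminH' : ∀ m, MvPowerSeries.coeff m H' ≠ 0 → r' + d ≤ m x + m y)
    (φ : PowerSeries K) (hφ : PowerSeries.constantCoeff φ = 0) (R R' : ℕ → PowerSeries K)
    (hR : ∀ j v, PowerSeries.coeff v (R j) = MvPowerSeries.coeff (Finsupp.single x (r + v) + Finsupp.single y j)
      (cleanSeries (p ^ e) (MvPowerSeries.subst (fun l => if l = y then
        (MvPowerSeries.X y : MvPowerSeries σ K) + PowerSeries.subst (MvPowerSeries.X x : MvPowerSeries σ K) (PowerSeries.X * φ)
        else MvPowerSeries.X l) H)))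
    (hR' : ∀ j v, PowerSeries.coeff v (R' j) = MvPowerSeries.coeff (Finsupp.single x (r' + v) + Finsupp.single y j)
      (cleanSeries (p ^ e) (MvPowerSeries.subst (fun l => if l = y then
        (MvPowerSeries.X y : MvPowerSeries σ K) + PowerSeries.subst (MvPowerSeries.X x : MvPowerSeries σ K) φ
        else MvPowerSeries.X l) H'))) :
    PowerSeries.coeff 0 (R' d) ≠ 0 := by
  classical
  have hXφ : PowerSeries.constantCoeff (PowerSeries.X * φ) = 0 := by
    rw [map_mul, PowerSeries.constantCoeff_X, zero_mul]
  obtain ⟨i, a, hia, hsum⟩ :=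
    cleanShift_rows_exists_degree_eq p e x y hxy hσ H r d hxr hminH hexH (PowerSeries.X * φ) hXφ R hR
  have hstep := coeff_cleanShift_step_row (p ^ e) x y hxy hσ H H' hH' r r' d hr' φ hφ R R' hR hR' i 0 (by omega)
  rw [zero_add, show d - i = a by omega] at hstep
  have hne : PowerSeries.coeff 0 (R' i) ≠ 0 := by rw [hstep]; exact hia
  have hid : i = d := by
    by_contra hne'
    have hne2 := hne
    rw [hR', Nat.add_zero] at hne2
    have h1 := (coeff_cleanSeries_of_ne_zero (p ^ e) _ _ hne2).1
    rw [h1] at hne2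
    obtain ⟨dd, hdd, -, -, hdeg⟩ := exists_coeff_ne_zero_of_coeff_subst_shift x y hxy hσ φ hφ H' _ hne2
    have h2 := hminH' dd hdd
    rw [ssa_left hxy, ssa_right hxy] at hdeg
    omega
  rw [hid] at hne
  exact hne

/-- **[HP24, Prop. 4 case (i)] on the numeral `s`**: `s′⟨φ⟩ + d! = s⟨x·φ⟩` — for the successor `H′` of the monomial
point step (`x^q·H′ = H(x,xy)`, `r′ + q = r + d`) and every shift `φ` at `a′`, the numeral of the flag `y + φ(x)` at `a′`
plus `d!` is the numeral of the flag `y + x·φ(x)` at `a` ("`coeff_{d_𝓖}(G′) = x^{−d_res}·coeff_{d_𝓕}(G)` … This proves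
that `s_𝓖 < s_𝓕`"). [cite: HauserPerlega2024, Prop. 4 proof case (i) p. 794 l. 22 – p. 795 l. 5] -/
theorem inf_rows_step_add_factorial (q : ℕ) (x y : σ) (hxy : x ≠ y) (hσ : ∀ l, l = x ∨ l = y)
    (H H' : MvPowerSeries σ K)
    (hH' : (MvPowerSeries.X x : MvPowerSeries σ K) ^ q * H' = MvPowerSeries.subst (fun l => if l = y then (MvPowerSeries.X x : MvPowerSeries σ K) * MvPowerSeries.X y
        else MvPowerSeries.X l) H)
    (r r' d : ℕ) (hr' : r' + q = r + d)
    (hminH : ∀ m, MvPowerSeries.coeff m H ≠ 0 → r + d ≤ m x + m y)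
    (φ : PowerSeries K) (hφ : PowerSeries.constantCoeff φ = 0) (R R' : ℕ → PowerSeries K)
    (hR : ∀ j v, PowerSeries.coeff v (R j) = MvPowerSeries.coeff (Finsupp.single x (r + v) + Finsupp.single y j)
      (cleanSeries q (MvPowerSeries.subst (fun l => if l = y then
        (MvPowerSeries.X y : MvPowerSeries σ K) + PowerSeries.subst (MvPowerSeries.X x : MvPowerSeries σ K) (PowerSeries.X * φ)
        else MvPowerSeries.X l) H)))
    (hR' : ∀ j v, PowerSeries.coeff v (R' j) = MvPowerSeries.coeff (Finsupp.single x (r' + v) + Finsupp.single y j)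
      (cleanSeries q (MvPowerSeries.subst (fun l => if l = y then
        (MvPowerSeries.X y : MvPowerSeries σ K) + PowerSeries.subst (MvPowerSeries.X x : MvPowerSeries σ K) φ
        else MvPowerSeries.X l) H'))) :
    (Finset.range d).inf (fun i => ((d.factorial / (d - i) : ℕ) : ℕ∞) * (R' i).order) + (d.factorial : ℕ∞) =
      (Finset.range d).inf (fun i => ((d.factorial / (d - i) : ℕ) : ℕ∞) * (R i).order) := by
  have hXφ : PowerSeries.constantCoeff (PowerSeries.X * φ) = 0 := by
    rw [map_mul, PowerSeries.constantCoeff_X, zero_mul]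
  have hstep := coeff_cleanShift_step_row q x y hxy hσ H H' hH' r r' d hr' φ hφ R R' hR hR'
  have hmin := cleanShift_rows_degree_ge q x y hxy hσ H r d hminH (PowerSeries.X * φ) hXφ R hR
  exact inf_rows_add_factorial_eq_of_step R R' (fun i hi a => hstep i a hi.le) hmin

/-- **[HP24, Prop. 4 case (i)], conclusion for the `s`-component**: if the numerals of all case-(i) flags at `a` are
bounded by `S` (finite and attained off the terminal cases — Proposition 3, `PointBlowupFlagMaximalShift`), then after
the monomial point step every flag `y + φ(x)` at `a′` has `s′⟨φ⟩ + d! ≤ S`; in particular `s′⟨φ⟩ < S` when `S < ∞`, i.e.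
`(d, 0, s_𝓖) < (d, 0, s)` lexicographically. [cite: HauserPerlega2024, Prop. 4 proof case (i) p. 794 l. 22 – p. 795 l. 5] -/
theorem inf_rows_step_lt_of_le (q : ℕ) (x y : σ) (hxy : x ≠ y) (hσ : ∀ l, l = x ∨ l = y)
    (H H' : MvPowerSeries σ K)
    (hH' : (MvPowerSeries.X x : MvPowerSeries σ K) ^ q * H' = MvPowerSeries.subst (fun l => if l = y then (MvPowerSeries.X x : MvPowerSeries σ K) * MvPowerSeries.X y
        else MvPowerSeries.X l) H)
    (r r' d : ℕ) (hr' : r' + q = r + d)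
    (hminH : ∀ m, MvPowerSeries.coeff m H ≠ 0 → r + d ≤ m x + m y)
    (Rfam : PowerSeries K → ℕ → PowerSeries K)
    (hRfam : ∀ ψ j v, PowerSeries.coeff v (Rfam ψ j) =
      MvPowerSeries.coeff (Finsupp.single x (r + v) + Finsupp.single y j)
        (cleanSeries q (MvPowerSeries.subst (fun l => if l = y then
        (MvPowerSeries.X y : MvPowerSeries σ K) + PowerSeries.subst (MvPowerSeries.X x : MvPowerSeries σ K) ψ
        else MvPowerSeries.X l) H)))
    (S : ℕ) (hS : ∀ ψ : PowerSeries K, PowerSeries.constantCoeff ψ = 0 →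
      (Finset.range d).inf (fun i => ((d.factorial / (d - i) : ℕ) : ℕ∞) * (Rfam ψ i).order) ≤ S)
    (φ : PowerSeries K) (hφ : PowerSeries.constantCoeff φ = 0) (R' : ℕ → PowerSeries K)
    (hR' : ∀ j v, PowerSeries.coeff v (R' j) = MvPowerSeries.coeff (Finsupp.single x (r' + v) + Finsupp.single y j)
      (cleanSeries q (MvPowerSeries.subst (fun l => if l = y then
        (MvPowerSeries.X y : MvPowerSeries σ K) + PowerSeries.subst (MvPowerSeries.X x : MvPowerSeries σ K) φ
        else MvPowerSeries.X l) H'))) :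
    (Finset.range d).inf (fun i => ((d.factorial / (d - i) : ℕ) : ℕ∞) * (R' i).order) + (d.factorial : ℕ∞) ≤ S ∧
      (Finset.range d).inf (fun i => ((d.factorial / (d - i) : ℕ) : ℕ∞) * (R' i).order) < S := by
  have hXφ : PowerSeries.constantCoeff (PowerSeries.X * φ) = 0 := by
    rw [map_mul, PowerSeries.constantCoeff_X, zero_mul]
  have heq := inf_rows_step_add_factorial q x y hxy hσ H H' hH' r r' d hr' hminH φ hφ (Rfam (PowerSeries.X * φ)) R'
    (hRfam (PowerSeries.X * φ)) hR'
  have hle : (Finset.range d).inf (fun i => ((d.factorial / (d - i) : ℕ) : ℕ∞) * (R' i).order) +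
      (d.factorial : ℕ∞) ≤ S := by
    rw [heq]; exact hS _ hXφ
  refine ⟨hle, ?_⟩
  set s' := (Finset.range d).inf (fun i => ((d.factorial / (d - i) : ℕ) : ℕ∞) * (R' i).order) with hs'
  have hne : s' ≠ ⊤ := by
    intro htop
    rw [htop, top_add] at hle
    exact absurd hle (by simp)
  have hn : s' = ((s'.toNat : ℕ) : ℕ∞) := (ENat.coe_toNat hne).symm
  rw [hn] at hle ⊢
  have hfac : 1 ≤ d.factorial := Nat.factorial_pos d
  have h1 : ((s'.toNat + d.factorial : ℕ) : ℕ∞) ≤ (S : ℕ∞) := by push_cast; exact hle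
  have h2 : s'.toNat + d.factorial ≤ S := by exact_mod_cast h1
  exact_mod_cast (show s'.toNat < S by omega)

end StepRows

end HauserPerlega2024

end Literature.AlgebraicGeometry.Resolution
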